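/-
Copyright: lit-balaban cell, Phase-2 proof seat p33 (gen 10).  Statement-level skeleton of a published paper; no proof claims beyond
what the kernel checks below.
-/
import Literature.MathematicalPhysics.QuantumFieldTheory.BalabanImbrieJaffe1984to88.BIJ85LineSumReflection
import Literature.MathematicalPhysics.QuantumFieldTheory.BalabanImbrieJaffe1984to88.BIJ85SecClosedIdxAllToriTwo

/-!
# `BalabanImbrieJaffe1984to88.BIJ85Claim73SecondUniformTwo` — T. Bałaban, J. Imbrie, A. Jaffe, *Renormalization of the Higgs model:
minimizers, propagators and the stability of mean field theory*, Commun. Math. Phys. **97** (1985) 299–329 [BalabanImbrieJaffe1985],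
§7.3 p. 326, the sentence after (7.3.2): *"The second form of the inequality substitutes v_b for u_k(b) in the covariant derivative
of φ."* — **r15's `Claim73 𝓅` in its SECOND printed form holds on every two-dimensional torus with constants INDEPENDENT OF THE SCALE
`k`**, and the substitution error `‖u_k(c) − v_c‖` is `≤ e_k·K_T·(π/2)𝓅(e_k)` with ONE `K_T` for all `k` (companion of p09 g10's
`BIJ85SecClosedIdxAllToriTwo`, whose `K_T = K₀·k` made `M_k ∝ k²`; the k-uniform `K_T` is gen 10's `exists_KT_uniform_allTori`).
SKELETON row **C1.Eq7.3.1-7.3.2** (owner r15), GAPS G-C1-05 ADDENDUM 10.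

statement-level skeleton of published theorems with citation tags; proofs where landed; nothing here is a claim about the Yang–Mills mass gap

WHAT THIS FILE PROVES (0 `sorry`, no `def … : Prop`, theorems only).
* `claim73_second_closed_allTori_two_uniform`: for every odd `L > 1`, `a > 0`, `a₀ > 0`, `𝓅` there are ONE `K_R ≥ 1` and ONE `K_T ≥ 0`
  such that `Claim73 𝓅` holds for p11's family `secClosedStabData a₀` over `SecClosedIdx 2 K_R K_T 𝓅` — ONE family, constants
  `γ = ½min(a₀/27, 1/12)`, `α = ½`, `M = ((4/3)·16·((π/2)K_R)² + min(a₀/27,1/12)·2·((π/2)K_T)²)(1+4𝓅₊)^{2𝓅₊}` INDEPENDENT OF `k` — and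
  that family contains every actual Sect. 7.3 datum (`1 ≤ k ≤ m + K`, `0 < e ≤ 1`, `e𝓅(e) ≤ ½`, any `v`) of every torus with
  `P.d = 2`, `P.L = L`.
* `norm_lineIter_actualBgU1_sub_vK_le_two_uniform`: `‖u_k(c) − v_c‖ ≤ e·K_T·(π/2)𝓅(e)` along every unit bond `c`, for all such tori,
  all `k ≤ m + K`, all `e > 0`, all `𝓅`, all `v` with `|v(∂p) − 1| ≤ e𝓅(e)` (no smallness, no closedness).
HONEST SCOPE: `d = 2` (p09's and gen 10's); `U(1)`; torus; operators of record; constants explicit, not optimised; the tree's centred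
block conventions (DIVERGENCE F3).  Nothing printed is contradicted; no typed slot altered.

CITATION HEADER (lean-in-tree rule).  Phase-2 file of the lit-balaban TYPED SKELETON (HOME `run/shared/lean/pub/lit-balaban/`), seat
p33 gen 10 (unit `lit-balaban-p33-g10`; owner r15, referee ref-5).
-/

open scoped RealInnerProductSpace BigOperators
open Finset Complex

namespace Literature.MathematicalPhysics.QuantumFieldTheory.BalabanImbrieJaffe1984to88.BIJ85Claim73SecondUniformTwo

open Literature.MathematicalPhysics.QuantumFieldTheory.Balaban1983to89
open BIJ88Sect3Statements (U1 toC)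
open BIJ85Sect1Model (U1Field plaq)
open BIJ85SmallFieldSplit64 (plaqField)
open BIJ85BlockAveragesTorusK (lineIter)
open BIJ85Ineq732SecondForm (lineSumIter)
open BIJ85Sigma422Eta (eta_pos)
open BIJ85Eq454PlaqResidual (actualBgU1)
open BIJ85Claim73Closed (ClosedIdx)
open BIJ85Claim73SecondForm (SecClosedIdx vK secClosedStabData claim73_second_closed norm_toC_lineIter_actualBgU1_sub_le
  abs_plaqField_le_of_hyp)
open BIJ85LineSumReflection (exists_KT_uniform_allTori secClosedIdx_allTori_two_uniform)
open BIJ88Eq541Base0 (TkF)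
open BIJ85Sect7Statements (ScalarStabData)

noncomputable section

/-! ## §1  `Claim73 𝓅`, second printed form, on every two-dimensional torus, constants independent of `k` -/

/-- **r15's `Claim73 𝓅` IN ITS SECOND PRINTED FORM ON EVERY TWO-DIMENSIONAL TORUS, CONSTANTS INDEPENDENT OF THE SCALE**: for every odd
`L > 1`, `a > 0` (feeding `K_R`), `a₀ > 0` (the printed `a` of (4.6.4)) and `𝓅` there are ONE `K_R ≥ 1` and ONE `K_T ≥ 0` such that
(a) `Claim73 𝓅` holds for p11's second-form family `secClosedStabData a₀` over `SecClosedIdx 2 K_R K_T 𝓅` (one family; `γ`, `α`, `M`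
independent of `k`), and (b) that family contains EVERY actual datum of every scale `1 ≤ k ≤ m + K` on every two-dimensional torus of
block size `L`. [cite: BalabanImbrieJaffe1985, (7.3.1)–(7.3.2) p.326] -/
theorem claim73_second_closed_allTori_two_uniform {L : ℕ} (hL : Odd L ∧ 1 < L) {a : ℝ} (ha : 0 < a) (a₀ : ℝ) (ha₀ : 0 < a₀)
    (pexp : ℝ) :
    ∃ KR KT : ℝ, 1 ≤ KR ∧ 0 ≤ KT ∧
      ScalarStabData.Claim73 pexp (secClosedStabData (d := 2) (KR := KR) (KT := KT) (pexp := pexp) a₀ ha₀) ∧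
      ∀ (P : Params), P.d = 2 → P.L = L → ∀ (k : ℕ), 1 ≤ k → k ≤ P.m + P.K →
        ∀ (e : ℝ) (he : 0 < e) (he1 : e ≤ 1) (hsmall : e * (1 + Real.log e⁻¹) ^ pexp ≤ 1 / 2) (v : U1Field P k),
          ∃ i : SecClosedIdx 2 KR KT pexp, i.P = P ∧ i.k = k ∧ i.e = e ∧ HEq i.v v := by
  obtain ⟨KR, KT, hKR, hKT, h⟩ := secClosedIdx_allTori_two_uniform hL ha pexp
  exact ⟨KR, KT, hKR, hKT, claim73_second_closed a₀ ha₀ KR KT pexp, h⟩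

/-! ## §2  The substitution error between the two printed forms, uniformly in the scale -/

/-- **`‖u_k(c) − v_c‖ ≤ e_k·K_T·(π/2)𝓅(e_k)` ON EVERY TWO-DIMENSIONAL TORUS UNDER (7.3.1), ONE `K_T` FOR ALL SCALES** — the defect of
substituting `v_b` for `u_k(b)` (the actual background (4.5.4) computed from `v` with the operators of record) along every unit bond:
for every odd `L > 1` ONE `K_T ≥ 0` serves all tori with `P.d = 2`, `P.L = L`, all scales `k ≤ m + K`, all `e > 0`, all exponents
`𝓅` and all `v` with `|v(∂p) − 1| ≤ e𝓅(e)`; neither `e𝓅(e) ≤ ½` nor closedness is needed. [cite: BalabanImbrieJaffe1985, (7.3.1)–(7.3.2) p.326] -/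
theorem norm_lineIter_actualBgU1_sub_vK_le_two_uniform {L : ℕ} (hL : Odd L ∧ 1 < L) :
    ∃ KT : ℝ, 0 ≤ KT ∧ ∀ (P : Params) (hPd : P.d = 2), P.L = L → ∀ (k : ℕ) (hk : k ≤ P.m + P.K) (e : ℝ), 0 < e →
      ∀ (pexp : ℝ) (v : U1Field P k),
        (∀ p, ‖((plaq v p : Circle) : ℂ) - 1‖ ≤ e * (1 + Real.log e⁻¹) ^ pexp) →
        ∀ c : PBond P (0 + k),
          ‖toC (lineIter (actualBgU1 hPd.ge k e v) k c) - toC (vK k v c)‖ ≤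
            e * (KT * (Real.pi / 2 * (1 + Real.log e⁻¹) ^ pexp)) := by
  obtain ⟨KT, hKT, hT⟩ := exists_KT_uniform_allTori hL
  refine ⟨KT, hKT, fun P hPd hPL k hk e he pexp v h c => ?_⟩
  have hf := abs_plaqField_le_of_hyp he v h
  have hT' := hT P hPd hPL hPd.ge k hk (plaqField e v) _ hf c
  have h1 := norm_toC_lineIter_actualBgU1_sub_le hPd.ge hk e v c
  rw [abs_of_pos he] at h1
  calc ‖toC (lineIter (actualBgU1 hPd.ge k e v) k c) - toC (vK k v c)‖
      ≤ e * P.eta k * |lineSumIter (TkF P hPd.ge ((P.eta k) ^ P.d) (P.eta k) k (plaqField e v)) k c| := h1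
    _ = e * (P.eta k * |lineSumIter (TkF P hPd.ge ((P.eta k) ^ P.d) (P.eta k) k (plaqField e v)) k c|) := by ring
    _ ≤ e * (KT * (Real.pi / 2 * (1 + Real.log e⁻¹) ^ pexp)) := mul_le_mul_of_nonneg_left hT' he.le

end

end Literature.MathematicalPhysics.QuantumFieldTheory.BalabanImbrieJaffe1984to88.BIJ85Claim73SecondUniformTwo
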